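import Summits.QuantumFields.YangMills.Theorems.BalabanLadderNTBoundaryLawCentred
import Literature.MathematicalPhysics.QuantumLattice.LatticeGaugeDLRBoxKernels
import HarnessLib

/-!
# Crux `NT` (stmt-QuantumFields-19353), stub `stub_cfp : CFP`: the sign-free conditional clustering clause FOLLOWS from `FBL`

Helper file (`--supports stmt-QuantumFields-19353`) of the fleet lead prover of crux `NT` (unit `ym-spine-19353-p1`,
g2).  The clause-level consumption audit (`Theorems/BalabanLadderNTWeakPackage*.lean`) showed that the composition
`NT_of = stub_lower` uses the UPPER half of the registered two-point clause `FC2 G r a` only as a SIGN-FREE clustering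
bound (A): `|‖u'−u‖⁸ · kerCov_{Q,η}(dens u, dens u')| ≤ C₂` for pairs deep inside an x-centred femto cube `Q`.  This file
proves that (A) is NOT independent engine content: **it follows from the femto boundary law `FBL G r a` alone**, by
conditional independence inside the cube kernel.

Mechanism (Georgii 2011, Def. 1.23 (iii) consistency + Remark 1.20 properness + (2.15) quasilocality, all landed for the
tree specification `ymSpecification`): put disjoint cubes `Q_u`, `Q_{u'}` of radius `R₁ ≍ ‖u'−u‖/4` around `u`, `u'`
inside `Q`.  With `f ζ = kerE_{Q_u,ζ}(dens u)`, `g ζ = kerE_{Q_{u'},ζ}(dens u')`: `E_Q[F G] = E_Q[f g]`, `E_Q F = E_Q f`,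
`E_Q G = E_Q g` (`kerE_mul_eq_kerE_condMul`: consistency in `Q_u`, `dens u'` is a cylinder off `Q_u`; consistency in
`Q_{u'}`, `f` is a cylinder off `Q_{u'}` by quasilocality), so `kerCov_Q(F, G) = Cov_Q(f, g)`; the boundary law gives
`|f − p β|, |g − p β| ≤ C₁/(R₁+1)⁴` uniformly in the exterior, hence `|kerCov_Q(F,G)| ≤ 4 C₁²/(R₁+1)⁸ ≤ 4·8⁸ C₁²/‖u'−u‖⁸`
(`abs_kerCov_le_of_subcubes`).  Consequence:

* `abs_of_fbl` — `FBL G r a` implies the clause (A) of the weak package VERBATIM, with collar `K ≡ 1`, threshold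
  `n₀ = 16`, range `ℓ₁`, constant `4 · 8⁸ · C₁²`; so the weak package of `nt_of_weakPackage` reduces to
  `units ∧ FBL ∧ (F) ∧ (T)` (`…NTWeakPackageOfFloor`, next file).
-/

set_option autoImplicit false

noncomputable section

open MeasureTheory Filter Topology
open Literature.MathematicalPhysics.QuantumFieldTheory Literature.MathematicalPhysics.QuantumLattice
open Literature.Probability.LatticeModels
open Summit.QuantumFields.YangMills.Cruxes.OSLegsFromFemtoAndGap.DlrCollarTransfer
open Summit.QuantumFields.YangMills.Cruxes.OSLegsFromFemtoAndGap.DlrCollarTransfer.StubLower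
  (mem_cubeSites_iff exists_abs_dens_le cubeEdges_window dens_supp_window le_depth_cube)
open Summit.QuantumFields.YangMills.Theorems.OSLegsFromFemtoAndGap.StubLower (sub_mul_mul_le_cov_of_kernel abs_apply_le_norm)

namespace Summit.QuantumFields.YangMills.Cruxes.NT.BoundaryLaw

/-! ## §1 Lattice geometry: a long coordinate, windows -/

/-- Some coordinate of a lattice vector carries at least half of its Euclidean norm (`‖w‖ ≤ 2 ‖w‖_∞` in `ℝ⁴`).
[folklore] -/
theorem exists_coord_ge_half_norm (w : Fin 4 → ℤ) : ∃ j : Fin 4, ‖siteToE w‖ ≤ 2 * |((w j : ℤ) : ℝ)| := by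
  by_contra h
  push Not at h
  have hsq : ‖siteToE w‖ ^ 2 = ∑ j, ((w j : ℤ) : ℝ) ^ 2 := by
    rw [EuclideanSpace.norm_sq_eq]
    refine Finset.sum_congr rfl fun j _ => ?_
    rw [siteToE_apply, Real.norm_eq_abs, sq_abs]
  have hlt : ∀ j, ((w j : ℤ) : ℝ) ^ 2 < (‖siteToE w‖ / 2) ^ 2 := fun j => by
    have h1 : |((w j : ℤ) : ℝ)| < ‖siteToE w‖ / 2 := by linarith [h j]
    calc ((w j : ℤ) : ℝ) ^ 2 = |((w j : ℤ) : ℝ)| ^ 2 := (sq_abs _).symm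
      _ < (‖siteToE w‖ / 2) ^ 2 := by
          exact pow_lt_pow_left₀ h1 (abs_nonneg _) two_ne_zero
  have hsum : ∑ j : Fin 4, ((w j : ℤ) : ℝ) ^ 2 < ∑ _j : Fin 4, (‖siteToE w‖ / 2) ^ 2 :=
    Finset.sum_lt_sum_of_nonempty Finset.univ_nonempty fun j _ => hlt j
  rw [Finset.sum_const, Finset.card_univ, Fintype.card_fin, ← hsq] at hsum
  have : (4 : ℕ) • (‖siteToE w‖ / 2) ^ 2 = ‖siteToE w‖ ^ 2 := by rw [nsmul_eq_mul]; push_cast; ring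
  rw [this] at hsum
  exact lt_irrefl _ hsum

section Kernel

variable (G : Type) [Group G] [TopologicalSpace G] [IsTopologicalGroup G] [CompactSpace G]
  [MeasurableSpace G] [BorelSpace G] (r : LatticeRep G)

/-! ## §2 Conditional independence of two separated sub-cubes inside a cube kernel -/

/-- **Two-cube factorisation inside a cube kernel.**  Let `Q_u, Q_{u'} ⊆ Q` be cubes (interior links nested), `F` a
bounded continuous cylinder observable whose kernel mean `f ζ = kerE_{Q_u,ζ} F` is a cylinder function with support
off the interior links of `Q_{u'}`, and `G'` a bounded continuous cylinder observable with support off the interior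
links of `Q_u`.  Then for every exterior `η` of `Q`:
`kerE_{Q,η}(F · G') = kerE_{Q,η}(ζ ↦ kerE_{Q_u,ζ} F · kerE_{Q_{u'},ζ} G')` (consistency in `Q_u`, properness pulls `G'`
out; consistency in `Q_{u'}`, properness pulls `f` out). [folklore] -/
theorem kerE_mul_eq_kerE_condMul (β : ℝ) {c cu cu' : Fin 4 → ℤ} {b bu bu' : ℕ}
    (hu : cubeEdges cu bu ⊆ cubeEdges c b) (hu' : cubeEdges cu' bu' ⊆ cubeEdges c b) (η : LGConfig 4 G)
    {F G' : LGConfig 4 G → ℝ} (hFc : Continuous F) (hGc : Continuous G') {MF MG : ℝ}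
    (hMF : ∀ U, |F U| ≤ MF) (hMG : ∀ U, |G' U| ≤ MG)
    {SG Tf : Finset (Literature.MathematicalPhysics.QuantumLattice.ZdEdge 4)}
    (hGS : IsCylinder G' SG) (hSG : ∀ e ∈ SG, e ∉ cubeEdges cu bu)
    (hfT : IsCylinder (fun ζ => kerE G r β cu bu ζ F) Tf) (hTf : ∀ e ∈ Tf, e ∉ cubeEdges cu' bu') :
    kerE G r β c b η (fun U => F U * G' U) =
      kerE G r β c b η (fun ζ => kerE G r β cu bu ζ F * kerE G r β cu' bu' ζ G') := by
  haveI := r.secondCountableTopology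
  have hF : Measurable F := hFc.measurable
  have hG : Measurable G' := hGc.measurable
  -- the kernel means as functions of the exterior
  have hfc : Continuous fun ζ => kerE G r β cu bu ζ F := by
    unfold kerE; exact continuous_integral_ymSpecification r.ρ r.continuous β _ hFc hMF
  have hfM : ∀ ζ, |kerE G r β cu bu ζ F| ≤ MF := fun ζ => abs_kerE_le G r β cu bu ζ hMF
  have hgc : Continuous fun ζ => kerE G r β cu' bu' ζ G' := by
    unfold kerE; exact continuous_integral_ymSpecification r.ρ r.continuous β _ hGc hMG
  have hMF0 : 0 ≤ MF := (abs_nonneg _).trans (hMF (fun _ => 1))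
  -- step 1: consistency in `Q_u` for `F · G'`, then properness pulls `G'` out
  have hFG : Measurable (fun U => F U * G' U) := hF.mul hG
  have hFGb : ∀ U, |F U * G' U| ≤ MF * MG := fun U => by
    rw [abs_mul]; exact mul_le_mul (hMF U) (hMG U) (abs_nonneg _) hMF0
  have h1 : kerE G r β c b η (fun U => F U * G' U) =
      kerE G r β c b η (fun ζ => kerE G r β cu bu ζ F * G' ζ) := by
    rw [← kerE_kerE_of_subset G r β hu η hFG hFGb]
    congr 1
    funext ζ
    unfold kerE
    exact integral_ymSpecification_mul_cyl r.ρ r.continuous β _ hF hG hGS hSG ζ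
  -- step 2: consistency in `Q_{u'}` for `f · G'`, then properness pulls `f` out
  have hfG : Measurable (fun ζ => kerE G r β cu bu ζ F * G' ζ) := hfc.measurable.mul hG
  have hfGb : ∀ ζ, |kerE G r β cu bu ζ F * G' ζ| ≤ MF * MG := fun ζ => by
    rw [abs_mul]; exact mul_le_mul (hfM ζ) (hMG ζ) (abs_nonneg _) hMF0
  have h2 : kerE G r β c b η (fun ζ => kerE G r β cu bu ζ F * G' ζ) =
      kerE G r β c b η (fun ζ => kerE G r β cu bu ζ F * kerE G r β cu' bu' ζ G') := by
    rw [← kerE_kerE_of_subset G r β hu' η hfG hfGb]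
    congr 1
    funext ζ
    unfold kerE
    exact integral_ymSpecification_cyl_mul r.ρ r.continuous β _ hG hfc.measurable hfT hTf ζ
  rw [h1, h2]

/-! ## §3 The conditional covariance of two separated sub-cube observables -/

end Kernel

section Cov

variable {Ω : Type*} [TopologicalSpace Ω] [CompactSpace Ω] [MeasurableSpace Ω] [OpensMeasurableSpace Ω]
  {μ : Measure Ω} [IsProbabilityMeasure μ]

/-- Two continuous functions within `h`, `h'` of constants have covariance at most `4 h h'` in absolute value under a
probability measure (tree `sub_mul_mul_le_cov_of_kernel`, both signs). [folklore] -/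
theorem abs_cov_le_of_close {f g : Ω → ℝ} (hf : Continuous f) (hg : Continuous g) {p p' h h' : ℝ}
    (hdf : ∀ ω, |f ω - p| ≤ h) (hdg : ∀ ω, |g ω - p'| ≤ h') :
    |∫ ω, f ω * g ω ∂μ - (∫ ω, f ω ∂μ) * (∫ ω, g ω ∂μ)| ≤ 4 * h * h' := by
  have hlow := sub_mul_mul_le_cov_of_kernel (μ := μ) (gA := f) (gB := g) (gAB := fun ω => f ω * g ω)
    hf hg (hf.mul hg) (m := 0) hdf hdg (fun ω => by simp)
  have hneg : ∀ ω, |(-g ω) - (-p')| ≤ h' := fun ω => by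
    rw [show (-g ω) - (-p') = -(g ω - p') by ring, abs_neg]; exact hdg ω
  have hup := sub_mul_mul_le_cov_of_kernel (μ := μ) (gA := f) (gB := fun ω => -g ω)
    (gAB := fun ω => -(f ω * g ω)) hf hg.neg (hf.mul hg).neg (m := 0) hdf hneg (fun ω => by simp)
  rw [integral_neg, integral_neg] at hup
  rw [abs_le]
  constructor <;> linarith

end Cov

section Kernel2

variable (G : Type) [Group G] [TopologicalSpace G] [IsTopologicalGroup G] [CompactSpace G]
  [MeasurableSpace G] [BorelSpace G] (r : LatticeRep G)

/-- **Conditional clustering from the boundary law (abstract form).**  In the situation of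
`kerE_mul_eq_kerE_condMul`, if the sub-cube kernel means are uniformly close to constants,
`|kerE_{Q_u,ζ} F − p| ≤ h` and `|kerE_{Q_{u'},ζ} G' − p'| ≤ h'` for every exterior `ζ`, then
`|kerCov_{Q,η}(F, G')| ≤ 4 h h'` for every exterior `η` of `Q` (law of total covariance; the conditional covariance
given the links off `Q_u ∪ Q_{u'}` vanishes). [folklore] -/
theorem abs_kerCov_le_of_subcubes (β : ℝ) {c cu cu' : Fin 4 → ℤ} {b bu bu' : ℕ}
    (hu : cubeEdges cu bu ⊆ cubeEdges c b) (hu' : cubeEdges cu' bu' ⊆ cubeEdges c b) (η : LGConfig 4 G)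
    {F G' : LGConfig 4 G → ℝ} (hFc : Continuous F) (hGc : Continuous G') {MF MG : ℝ}
    (hMF : ∀ U, |F U| ≤ MF) (hMG : ∀ U, |G' U| ≤ MG)
    {SG Tf : Finset (Literature.MathematicalPhysics.QuantumLattice.ZdEdge 4)}
    (hGS : IsCylinder G' SG) (hSG : ∀ e ∈ SG, e ∉ cubeEdges cu bu)
    (hfT : IsCylinder (fun ζ => kerE G r β cu bu ζ F) Tf) (hTf : ∀ e ∈ Tf, e ∉ cubeEdges cu' bu')
    {p p' h h' : ℝ} (hdF : ∀ ζ, |kerE G r β cu bu ζ F - p| ≤ h) (hdG : ∀ ζ, |kerE G r β cu' bu' ζ G' - p'| ≤ h') :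
    |kerCov G r β c b η F G'| ≤ 4 * h * h' := by
  haveI := r.secondCountableTopology
  haveI := isProbabilityMeasure_ymSpecification r.ρ r.continuous β (cubeEdges c b) η
  have hF : Measurable F := hFc.measurable
  have hG : Measurable G' := hGc.measurable
  have hfc : Continuous fun ζ => kerE G r β cu bu ζ F := by
    unfold kerE; exact continuous_integral_ymSpecification r.ρ r.continuous β _ hFc hMF
  have hgc : Continuous fun ζ => kerE G r β cu' bu' ζ G' := by
    unfold kerE; exact continuous_integral_ymSpecification r.ρ r.continuous β _ hGc hMG
  -- `kerCov_Q(F, G') = Cov_Q(f, g)`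
  have hprod := kerE_mul_eq_kerE_condMul G r β hu hu' η hFc hGc hMF hMG hGS hSG hfT hTf
  have hEF : kerE G r β c b η F = kerE G r β c b η (fun ζ => kerE G r β cu bu ζ F) :=
    (kerE_kerE_of_subset G r β hu η hF hMF).symm
  have hEG : kerE G r β c b η G' = kerE G r β c b η (fun ζ => kerE G r β cu' bu' ζ G') :=
    (kerE_kerE_of_subset G r β hu' η hG hMG).symm
  unfold kerCov
  rw [hprod, hEF, hEG]
  exact abs_cov_le_of_close (μ := ymSpecification (d := 4) r.ρ β (cubeEdges c b) η)
    (f := fun ζ => kerE G r β cu bu ζ F) (g := fun ζ => kerE G r β cu' bu' ζ G') hfc hgc hdF hdG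

end Kernel2


/-! ## §4 Geometry of two separated sites and their cubes -/

section Geometry

variable (G : Type) [Group G] [TopologicalSpace G] [IsTopologicalGroup G] [CompactSpace G]
  [MeasurableSpace G] [BorelSpace G] (r : LatticeRep G)

/-- If `u'` is at least `R₁ + 2` away from `u` along the coordinate `j₀`, the support of `dens u'` misses the interior
links of the cube of radius `R₁` around `u`. [folklore] -/
theorem dens_supp_not_mem_cube {u u' : Fin 4 → ℤ} {R₁ : ℕ} {j₀ : Fin 4} (hfar : (R₁ : ℤ) + 2 ≤ |u' j₀ - u j₀|) :
    ∀ e ∈ r.curvature.supp.image (fun e => (e.1 + u', e.2)), e ∉ cubeEdges (fun j => u j - R₁) (2 * R₁ + 1) := by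
  intro e he hcube
  have h1 := dens_supp_window G r u' u' 1 (fun j => by simp) e he j₀
  have h2 := cubeEdges_window u R₁ e hcube j₀
  have h3 : |u' j₀ - u j₀| ≤ (R₁ : ℤ) + 1 := by
    rw [abs_le]; push_cast at h1; constructor <;> linarith [h1.1, h1.2, h2.1, h2.2]
  linarith

/-- If `u'` is at least `2R₁ + 3` away from `u` along the coordinate `j₀`, the quasilocal support of the `Q_u`-kernel
mean of `dens u` (support of `dens u` together with the edges of the plaquettes touching the interior links of the cube
`Q_u` of radius `R₁` around `u`) misses the interior links of the cube of radius `R₁` around `u'`. [folklore] -/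
theorem condMean_supp_not_mem_cube {u u' : Fin 4 → ℤ} {R₁ : ℕ} {j₀ : Fin 4}
    (hfar : 2 * (R₁ : ℤ) + 3 ≤ |u' j₀ - u j₀|) :
    ∀ e ∈ r.curvature.supp.image (fun e => (e.1 + u, e.2)) ∪
        (plaquettesTouching (cubeEdges (fun j => u j - R₁) (2 * R₁ + 1))).biUnion plaquetteEdges,
      e ∉ cubeEdges (fun j => u' j - R₁) (2 * R₁ + 1) := by
  intro e he hcube
  have h2 := cubeEdges_window u' R₁ e hcube j₀
  have h1 : |e.1 j₀ - u j₀| ≤ (R₁ : ℤ) + 1 := by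
    rcases Finset.mem_union.1 he with hA | hB
    · have h := dens_supp_window G r u u 1 (fun j => by simp) e hA j₀
      push_cast at h
      rw [abs_le]; constructor <;> linarith [h.1, h.2]
    · obtain ⟨e₀, he₀, hnear⟩ := exists_near_of_mem_plaquettesTouching_biUnion hB
      have h := cubeEdges_window u R₁ e₀ he₀ j₀
      have hn := abs_le.1 (hnear j₀)
      rw [abs_le]; constructor <;> linarith [h.1, h.2, hn.1, hn.2]
  have h3 : |u' j₀ - u j₀| ≤ 2 * (R₁ : ℤ) + 1 := by
    have h1' := abs_le.1 h1
    rw [abs_le]; constructor <;> linarith [h1'.1, h1'.2, h2.1, h2.2]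
  linarith

end Geometry

/-! ## §5 The sign-free clustering clause (A) from the boundary law -/

section Clause

variable (G : Type) [Group G] [TopologicalSpace G] [IsTopologicalGroup G] [CompactSpace G]
  [MeasurableSpace G] [BorelSpace G] (r : LatticeRep G)

/-- **The sign-free conditional clustering clause (A) follows from `FBL`.**  For a unit map with the femto boundary law
`FBL G r a` (witnesses `C₁, β₁, ℓ₁`): for `β ≥ β₁`, every x-centred femto cube `Q = [x−R, x+R]⁴` (`(2R+1) · a β ≤ ℓ₁`),
every exterior `η` and every pair `u, u'` with `‖u'−u‖ ≥ 16` at depth `≥ ‖u'−u‖` in `Q`: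
`|‖u'−u‖⁸ · kerCov_{Q,η}(dens u, dens u')| ≤ 4 · 8⁸ · C₁²` — the clause (A) of `WeakPackage.lowerBounds_of_weakPackage`
VERBATIM with collar `K ≡ 1`, threshold `n₀ = 16`, range `ℓ₂ = ℓ₁`, threshold `β₂ = β₁` (disjoint cubes of radius
`R₁ ≍ ‖u'−u‖/4` around `u`, `u'`; `abs_kerCov_le_of_subcubes`; the boundary law in each). [folklore] -/
theorem abs_of_fbl (a : ℝ → ℝ) (h : FBL G r a) :
    ∃ (β₂ ℓ₂ C₂ : ℝ) (K : ℝ → ℝ) (n₀ : ℕ), 0 < ℓ₂ ∧ (∀ s, 1 ≤ K s) ∧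
      Tendsto (fun s : ℝ => s * K s) (nhdsWithin 0 (Set.Ioi 0)) (nhds 0) ∧ 1 ≤ n₀ ∧
      ∀ β : ℝ, β₂ ≤ β → ∀ (x : Fin 4 → ℤ) (R : ℕ), ((2 * R + 1 : ℕ) : ℝ) * a β ≤ ℓ₂ →
        ∀ (η : LGConfig 4 G) (u u' : Fin 4 → ℤ) (s₀ : ℝ), 0 < s₀ → s₀ ≤ ‖siteToE (u' - u)‖ * a β →
          ‖siteToE (u' - u)‖ * a β ≤ ℓ₂ → (n₀ : ℝ) ≤ ‖siteToE (u' - u)‖ →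
            K s₀ * ‖siteToE (u' - u)‖ ≤ depth (fun j => x j - R) (2 * R + 1) u →
            K s₀ * ‖siteToE (u' - u)‖ ≤ depth (fun j => x j - R) (2 * R + 1) u' →
              |‖siteToE (u' - u)‖ ^ 8 *
                  kerCov G r β (fun j => x j - R) (2 * R + 1) η (dens G r u) (dens G r u')| ≤ C₂ := by
  haveI := r.secondCountableTopology
  obtain ⟨C₁, β₁, ℓ₁, p, hℓ₁, hC₁, H⟩ := h
  obtain ⟨M, -, hM⟩ := exists_abs_dens_le G r
  refine ⟨β₁, ℓ₁, 4 * 8 ^ 8 * C₁ ^ 2, fun _ => 1, 16, hℓ₁, fun _ => le_rfl, ?_, by norm_num, ?_⟩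
  · have h0 : Tendsto (fun s : ℝ => s) (nhdsWithin 0 (Set.Ioi 0)) (nhds 0) :=
      tendsto_id.mono_left nhdsWithin_le_nhds
    simpa only [mul_one] using h0
  intro β hβ x R hb η u u' s₀ _hs₀ _hs₀le _hle hn hKu hKu'
  simp only [one_mul] at hKu hKu'
  set ν : ℝ := ‖siteToE (u' - u)‖ with hν
  have hν16 : (16 : ℝ) ≤ ν := by exact_mod_cast hn
  have hν0 : 0 < ν := by linarith
  -- a long coordinate `j₀`: `ν ≤ 2 |u' j₀ − u j₀| ≤ 2 ν`
  obtain ⟨j₀, hj₀⟩ := exists_coord_ge_half_norm (u' - u)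
  rw [Pi.sub_apply, Int.cast_sub] at hj₀
  have hle_ν : |((u' j₀ : ℤ) : ℝ) - u j₀| ≤ ν := by
    have := abs_apply_le_norm (siteToE (u' - u)) j₀
    rwa [siteToE_apply, Pi.sub_apply, Int.cast_sub] at this
  -- the integer distance `m` and the radius `R₁ = ⌊(m − 3)/2⌋`
  obtain ⟨m, hm⟩ : ∃ m : ℕ, (m : ℤ) = |u' j₀ - u j₀| := ⟨(u' j₀ - u j₀).natAbs, Int.natCast_natAbs _⟩
  have hmR : (m : ℝ) = |((u' j₀ : ℤ) : ℝ) - u j₀| := by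
    have := congrArg (fun z : ℤ => (z : ℝ)) hm
    simpa [Int.cast_abs, Int.cast_sub] using this
  have hm8 : 8 ≤ m := by
    have : (8 : ℝ) ≤ m := by rw [hmR]; linarith
    exact_mod_cast this
  obtain ⟨R₁, hR₁⟩ : ∃ R₁ : ℕ, R₁ = (m - 3) / 2 := ⟨_, rfl⟩
  have hR₁1 : 1 ≤ R₁ := by omega
  have hR₁m : 2 * R₁ + 3 ≤ m := by omega
  have hmR₁ : m ≤ 2 * R₁ + 4 := by omega
  have hfar : 2 * (R₁ : ℤ) + 3 ≤ |u' j₀ - u j₀| := by rw [← hm]; exact_mod_cast hR₁m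
  have hfar2 : (R₁ : ℤ) + 2 ≤ |u' j₀ - u j₀| := by
    have : (0 : ℤ) ≤ R₁ := by positivity
    linarith
  have hνR₁ : ν / 8 ≤ (R₁ : ℝ) + 1 := by
    have h1 : (m : ℝ) ≤ 2 * R₁ + 4 := by exact_mod_cast hmR₁
    rw [hmR] at h1
    linarith
  have hR₁ν : (R₁ : ℝ) + 1 ≤ ν := by
    have h1 : (2 * R₁ + 3 : ℝ) ≤ m := by exact_mod_cast hR₁m
    rw [hmR] at h1
    linarith
  -- the sub-cubes `Q_u`, `Q_{u'}` of radius `R₁` fit in `Q`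
  have hdu : R₁ + 1 ≤ depth (fun j => x j - R) (2 * R + 1) u := by
    have : ((R₁ + 1 : ℕ) : ℝ) ≤ depth (fun j => x j - R) (2 * R + 1) u := by push_cast; linarith
    exact_mod_cast this
  have hdu' : R₁ + 1 ≤ depth (fun j => x j - R) (2 * R + 1) u' := by
    have : ((R₁ + 1 : ℕ) : ℝ) ≤ depth (fun j => x j - R) (2 * R + 1) u' := by push_cast; linarith
    exact_mod_cast this
  have hsubu : cubeEdges (fun j => u j - R₁) (2 * R₁ + 1) ⊆ cubeEdges (fun j => x j - R) (2 * R + 1) :=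
    cubeEdges_subset (centredCube_subset_of_le_depth hdu)
  have hsubu' : cubeEdges (fun j => u' j - R₁) (2 * R₁ + 1) ⊆ cubeEdges (fun j => x j - R) (2 * R + 1) :=
    cubeEdges_subset (centredCube_subset_of_le_depth hdu')
  -- the sub-cubes are femto
  have hside : 2 * R₁ + 1 ≤ 2 * R + 1 := two_mul_add_one_le_of_le_depth hdu
  have hb₁ : ((2 * R₁ + 1 : ℕ) : ℝ) * a β ≤ ℓ₁ := by
    rcases le_or_gt 0 (a β) with ha | ha
    · have h2 : ((2 * R₁ + 1 : ℕ) : ℝ) ≤ ((2 * R + 1 : ℕ) : ℝ) := by exact_mod_cast hside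
      exact (mul_le_mul_of_nonneg_right h2 ha).trans hb
    · exact (mul_nonpos_iff.2 (Or.inl ⟨by positivity, ha.le⟩)).trans hℓ₁.le
  -- the boundary law in each sub-cube at its centre
  have hbl : ∀ (v : Fin 4 → ℤ) (ζ : LGConfig 4 G),
      |kerE G r β (fun j => v j - R₁) (2 * R₁ + 1) ζ (dens G r v) - p β| ≤ C₁ / ((R₁ : ℝ) + 1) ^ 4 := by
    intro v ζ
    have hdv := le_depth_cube v v R₁ (t := 0) (fun j => by simp)
    rw [sub_zero] at hdv
    have h2v : 2 ≤ depth (fun j => v j - R₁) (2 * R₁ + 1) v := by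
      have : ((2 : ℕ) : ℝ) ≤ depth (fun j => v j - R₁) (2 * R₁ + 1) v := by
        have : (2 : ℝ) ≤ (R₁ : ℝ) + 1 := by exact_mod_cast Nat.succ_le_succ hR₁1
        push_cast; linarith
      exact_mod_cast this
    refine (H β hβ _ _ hb₁ ζ v h2v).trans ?_
    exact div_le_div_of_nonneg_left hC₁ (by positivity) (pow_le_pow_left₀ (by positivity) hdv 4)
  -- conditional independence: `|kerCov| ≤ 4 h²`, `h = C₁/(R₁+1)⁴`
  have hcyl : IsCylinder (fun ζ => kerE G r β (fun j => u j - R₁) (2 * R₁ + 1) ζ (dens G r u))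
      (r.curvature.supp.image (fun e => (e.1 + u, e.2)) ∪
        (plaquettesTouching (cubeEdges (fun j => u j - R₁) (2 * R₁ + 1))).biUnion plaquetteEdges) := by
    unfold kerE
    exact dependsOn_integral_ymSpecification r.ρ r.continuous β _ (continuous_dens r u).measurable
      (StubLower.isCylinder_dens G r u)
  have hcov := abs_kerCov_le_of_subcubes G r β hsubu hsubu' η (continuous_dens r u) (continuous_dens r u')
    (hM u) (hM u') (StubLower.isCylinder_dens G r u') (dens_supp_not_mem_cube G r hfar2) hcyl
    (condMean_supp_not_mem_cube G r hfar) (hbl u) (hbl u')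
  -- arithmetic: `ν⁸ · 4 (C₁/(R₁+1)⁴)² ≤ 4 · 8⁸ C₁²` since `ν/8 ≤ R₁ + 1`
  have hh : C₁ / ((R₁ : ℝ) + 1) ^ 4 ≤ C₁ / (ν / 8) ^ 4 :=
    div_le_div_of_nonneg_left hC₁ (by positivity) (pow_le_pow_left₀ (by positivity) hνR₁ 4)
  have hh0 : 0 ≤ C₁ / ((R₁ : ℝ) + 1) ^ 4 := by positivity
  rw [abs_mul, abs_of_nonneg (by positivity : (0 : ℝ) ≤ ν ^ 8)]
  calc ν ^ 8 * |kerCov G r β (fun j => x j - R) (2 * R + 1) η (dens G r u) (dens G r u')|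
      ≤ ν ^ 8 * (4 * (C₁ / ((R₁ : ℝ) + 1) ^ 4) * (C₁ / ((R₁ : ℝ) + 1) ^ 4)) :=
        mul_le_mul_of_nonneg_left hcov (by positivity)
    _ ≤ ν ^ 8 * (4 * (C₁ / (ν / 8) ^ 4) * (C₁ / (ν / 8) ^ 4)) := by gcongr
    _ = 4 * 8 ^ 8 * C₁ ^ 2 := by field_simp

end Clause

end Summit.QuantumFields.YangMills.Cruxes.NT.BoundaryLaw

end
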